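import Mathlib
import Summits.CriticalPhenomena.CardyFormulaZ2.Theorems.CardyMagicRigidityNestingRigidityUVExpMomentsDilation
import Summits.CriticalPhenomena.CardyFormulaZ2.Theorems.CardyMagicRigidityNestingRigidityBondTranslation
import Literature.Probability.Percolation.SiteNestingWeightBound
import Literature.Probability.Percolation.TriLatticeRounding
import HarnessLib

/-!
# Crux `NestingRigidity`, line `positive-cone-weight-doubling`: the number of MICROSCOPIC loops in a
# ball of radius `κδ` is bounded by a constant depending on `κ` only (both lattices, all centres)

Crux `Summit.CriticalPhenomena.CardyFormulaZ2.Theses.CardyMagicRigidity.NestingRigidity`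
(stmt-CriticalPhenomena-4835), line `positive-cone-weight-doubling`, registered helper Ξ
`uvFarBite_expMoment_latticeEnsembles` (all-order centred exponential moments of the far UV bite
statistic).  The multi-scale proof treats the loops of diameter `≳ c₀ δ` by keystone K6 (all-order
exponential moments of big-loop counts, one constant for all scales by dilation covariance); the
finitely many dyadic scales BELOW `c₀ δ` (down to the lattice scale) are handled deterministically:
the number of loops of `X_δ` with trace inside a ball of radius `κ δ` is at most `M(κ)`, uniformly
in the mesh, the centre and the configuration.  This file proves this (no cited fact, no
definition):

* §1 dilation (`loops_mul_latticeEnsembles`): the loops of `X_δ` inside `B(x, κδ)` are the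
  `δ`-dilates of the loops of `X_1` inside `B(x/δ, κ)`;
* §2 bond-`ℤ²` at mesh `1`, all centres: translate by the lattice point `⌊y⌋` (…BondTranslation)
  and use the configuration-uniform bound `ncard_loops_meeting_le` at the origin;
* §3 site-`𝕋` at mesh `1`, all centres: a loop inside `B(y, κ)` is THE interface loop through a face
  within `κ + 2` of `y` (centre-`y` version of `exists_face_of_range_inter_closedBall_nonempty`), and
  the faces within `κ + 2` of `y`, shifted by a lattice point within `7/10` of `y`
  (`exists_dist_triMeshPoint_le`), are faces within `κ + 3` of the origin;
* §4 both lattices, all meshes (`exists_ncard_loops_subset_ball_le`).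
-/

noncomputable section

open MeasureTheory Set Filter Metric
open scoped Real Topology BigOperators Pointwise

namespace Summit.CriticalPhenomena.CardyFormulaZ2.Cruxes.NestingRigidity.PositiveConeWeightDoubling

open Literature.Probability.RandomPlanarGeometry Literature.Probability.Percolation
  Literature.Probability.LatticeModels
open Summit.CriticalPhenomena.CardyFormulaZ2.Cruxes.NestingRigidity.RingCloudTomography
open Summit.CriticalPhenomena.CardyFormulaZ2.Cruxes.NestingRigidity.MarkovCascadeOneGeneration
  (continuous_translate isometry_translate range_map_translate)
open Summit.CriticalPhenomena.CardyFormulaZ2.Cruxes.MagicFormulaT.LineSketch (imageOn_mul_injective)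

namespace UVFarBite

/-! ## §1 Dilation: loops inside `B(x, κδ)` at mesh `δ` are dilated mesh-`1` loops -/

/-- Among the `c`-dilates of a loop family, the loops inside `B(x, ρ)` are the dilates of the loops
of the family inside `B(x/c, ρ/c)`. -/
theorem sep_subset_ball_image_mul {c : ℝ} (hc : 0 < c) (L : Set (UnbasedLoop ℂ)) (x : ℂ) (ρ : ℝ) :
    {u ∈ UnbasedLoop.imageOn (fun z ↦ (c : ℂ) * z) univ '' L | u.range ⊆ ball x ρ} =
      UnbasedLoop.imageOn (fun z ↦ (c : ℂ) * z) univ ''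
        {u ∈ L | u.range ⊆ ball ((c : ℂ)⁻¹ * x) (ρ / c)} := by
  have hc0 : (c : ℂ) ≠ 0 := Complex.ofReal_ne_zero.2 hc.ne'
  have hnorm : ‖(c : ℂ)‖ = c := by rw [Complex.norm_real, Real.norm_of_nonneg hc.le]
  have hball : ball x ρ = (c : ℂ) • ball ((c : ℂ)⁻¹ * x) (ρ / c) := by
    rw [_root_.smul_ball hc0, smul_eq_mul, mul_inv_cancel_left₀ hc0, hnorm, mul_div_cancel₀ _ hc.ne']
  have hiff : ∀ u : UnbasedLoop ℂ,
      (UnbasedLoop.imageOn (fun z ↦ (c : ℂ) * z) univ u).range ⊆ ball x ρ ↔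
        u.range ⊆ ball ((c : ℂ)⁻¹ * x) (ρ / c) := fun u ↦ by
    rw [UVExpMoments.range_imageOn_mul, hball, Set.smul_set_subset_smul_set_iff₀ hc0]
  ext v
  simp only [mem_setOf_eq, mem_image]
  constructor
  · rintro ⟨⟨u, hu, rfl⟩, hv⟩
    exact ⟨u, ⟨hu, (hiff u).1 hv⟩, rfl⟩
  · rintro ⟨u, ⟨hu, hq⟩, rfl⟩
    exact ⟨⟨u, hu, rfl⟩, (hiff u).2 hq⟩

/-- **Both lattices**: the loops of `X_δ(ω)` inside `B(x, κδ)` are the `δ`-dilates of the loops of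
`X_1(ω)` inside `B(x/δ, κ)` (`loops_mul_latticeEnsembles`). -/
theorem sep_subset_ball_eq_image_mesh_one : ∀ E ∈ latticeEnsembles, ∀ {δ : ℝ}, 0 < δ →
    ∀ (κ : ℝ) (x : ℂ) (ω : E.Ω),
      {u ∈ (E.X δ ω).loops | u.range ⊆ ball x (κ * δ)} =
        UnbasedLoop.imageOn (fun z ↦ (δ : ℂ) * z) univ ''
          {u ∈ (E.X 1 ω).loops | u.range ⊆ ball ((δ : ℂ)⁻¹ * x) κ} := by
  intro E hE δ hδ κ x ω
  have hX : E.X δ ω = E.X (δ * 1) ω := by rw [mul_one]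
  rw [hX, loops_mul_latticeEnsembles E hE δ 1 ω, sep_subset_ball_image_mul hδ,
    mul_div_cancel_right₀ _ hδ.ne']

/-! ## §2 Bond-`ℤ²` at mesh `1`: a configuration- and centre-uniform bound -/

/-- **Bond-`ℤ²`, mesh `1`, all centres**: the loops of `X_1(ω)` inside `B(y, κ)` are at most
`M(κ)` in number, uniformly in `y` and `ω` (translate by `⌊y⌋ ∈ ℤ²` and count the loops meeting
`B̄(0, κ + 2)`, `ncard_loops_meeting_le`). -/
theorem exists_ncard_sep_subset_ball_le_zEns_one (κ : ℝ) : ∃ M : ℕ, ∀ (y : ℂ) (ω : BondConfig (Site 2)),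
    {u ∈ (zEns.X 1 ω).loops | u.range ⊆ ball y κ}.Finite ∧
      {u ∈ (zEns.X 1 ω).loops | u.range ⊆ ball y κ}.ncard ≤ M := by
  refine ⟨(finite_setOf_corner_norm_le one_pos (κ + 2 + |(1 : ℝ)|)).toFinset.card, fun y ω ↦ ?_⟩
  -- finiteness (not uniform): these loops meet `B̄(0, ‖y‖ + κ)`
  have hfin : {u ∈ (zEns.X 1 ω).loops | u.range ⊆ ball y κ}.Finite := by
    refine (ncard_loops_meeting_le one_pos (‖y‖ + κ) ω).1.subset ?_
    rintro u ⟨hu, hR⟩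
    obtain ⟨z, hz⟩ := u.range_nonempty
    refine ⟨hu, z, hz, mem_closedBall.2 ?_⟩
    have h1 := mem_ball.1 (hR hz)
    calc dist z 0 ≤ dist z y + dist y 0 := dist_triangle _ _ _
      _ ≤ ‖y‖ + κ := by rw [dist_zero_right]; linarith
  refine ⟨hfin, ?_⟩
  -- the lattice point below-left of `y`
  set w : Site 2 := ![⌊y.re⌋, ⌊y.im⌋] with hw
  set b : ℂ := meshPoint 1 w with hb
  have hbre : b.re = ⌊y.re⌋ := by simp [hb, hw, meshPoint]
  have hbim : b.im = ⌊y.im⌋ := by simp [hb, hw, meshPoint]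
  have hyb : dist y b < 2 := by
    rw [dist_eq_norm]
    refine (Complex.norm_le_abs_re_add_abs_im _).trans_lt ?_
    rw [Complex.sub_re, Complex.sub_im, hbre, hbim, abs_of_nonneg (by linarith [Int.floor_le y.re]),
      abs_of_nonneg (by linarith [Int.floor_le y.im])]
    linarith [Int.lt_floor_add_one y.re, Int.lt_floor_add_one y.im]
  -- translate the configuration
  set ω' : BondConfig (Site 2) := BondConfig.relabel (sym2Equiv (Site.shift (-w))) ω with hω'
  have hω : BondConfig.relabel (sym2Equiv (Site.shift w)) ω' = ω := by
    have h := BondTranslation.relabel_shift_neg_relabel_shift (-w) ω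
    rwa [neg_neg] at h
  have hloops : (zEns.X 1 ω).loops =
      UnbasedLoop.map ⟨fun z : ℂ ↦ 1 * z + b, continuous_translate b⟩ (isometry_translate b) ''
        (zEns.X 1 ω').loops := by
    rw [← hω]
    exact BondTranslation.loops_zEns_relabel_shift 1 w ω'
  rw [hloops, BondTranslation.ncard_sep_image_translate b (zEns.X 1 ω').loops
    (fun u ↦ u.range ⊆ ball y κ) (fun u ↦ u.range ⊆ ball (y - b) κ) fun u ↦ by
      rw [range_map_translate, Set.image_subset_iff]
      refine Eq.to_iff (congrArg (u.range ⊆ ·) (Set.ext fun z ↦ ?_))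
      simp only [mem_preimage, mem_ball]
      rw [dist_eq_norm, dist_eq_norm, show z + b - y = z - (y - b) by ring]]
  -- count the loops meeting `B̄(0, κ + 2)`
  obtain ⟨hfin', hle⟩ := ncard_loops_meeting_le one_pos (κ + 2) ω'
  refine le_trans (Set.ncard_le_ncard ?_ hfin') hle
  rintro u ⟨hu, hR⟩
  obtain ⟨z, hz⟩ := u.range_nonempty
  refine ⟨hu, z, hz, mem_closedBall.2 ?_⟩
  have h1 := mem_ball.1 (hR hz)
  have h2 : dist (y - b) 0 < 2 := by rwa [dist_zero_right, ← dist_eq_norm]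
  linarith [dist_triangle z (y - b) 0]

/-! ## §3 Site-`𝕋` at mesh `1`: a configuration- and centre-uniform bound -/

/-- **A loop of `siteLoopConfig δ ω` meeting `B̄(y, R)` is the interface loop through a face within
`R + 2δ` of `y`** (the centre-`y` version of `exists_face_of_range_inter_closedBall_nonempty`). -/
theorem exists_face_near_of_range_inter_closedBall_nonempty {ω : SiteConfig (Site 2)} {δ : ℝ}
    (hδ : 0 < δ) {y : ℂ} {R : ℝ} {u : UnbasedLoop ℂ} (hu : u ∈ (siteLoopConfig δ ω).loops)
    (hR : (u.range ∩ closedBall y R).Nonempty) :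
    ∃ (F : HexVertex) (w : hexGraph.Walk F F), IsSiteInterfaceLoop ω w ∧
      UnbasedLoop.mk (BasedLoop.mk (siteLoopCurve δ w) (isLoop_siteLoopCurve δ w)) = u ∧
        dist ((δ : ℂ) * hexCenter F) y ≤ R + 2 * δ := by
  rcases hu with ⟨v, γ, hγ, -, rfl⟩ | ⟨v, γ, hγ, -, rfl⟩ <;>
  · obtain ⟨z, hz, hzR⟩ := hR
    have hlen : 0 < γ.length := by have := hγ.isCycle.three_le_length; omega
    rw [range_mk_siteLoopCurve, range_toCurve_eq_polyTrace hlen, mem_polyTrace_iff_exists_dart] at hz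
    obtain ⟨d, hd, hzd⟩ := hz
    obtain ⟨e, he, -, -⟩ := hγ.2 d hd
    obtain ⟨h1, h2⟩ := hexCenter_triEdgeFaces_mem_closedBall hδ.le e
    rw [he] at h1 h2
    have hzc : z ∈ closedBall (triMeshPoint δ e.fst) δ :=
      (convex_closedBall _ _).segment_subset h2 h1 hzd
    have hdist : dist z ((δ : ℂ) * hexCenter d.fst) ≤ 2 * δ :=
      calc dist z ((δ : ℂ) * hexCenter d.fst)
          ≤ dist z (triMeshPoint δ e.fst) + dist ((δ : ℂ) * hexCenter d.fst) (triMeshPoint δ e.fst) :=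
            dist_triangle_right _ _ _
        _ ≤ δ + δ := add_le_add (mem_closedBall.1 hzc) (mem_closedBall.1 h2)
        _ = 2 * δ := by ring
    have hnear : dist ((δ : ℂ) * hexCenter d.fst) y ≤ R + 2 * δ :=
      calc dist ((δ : ℂ) * hexCenter d.fst) y ≤ dist z ((δ : ℂ) * hexCenter d.fst) + dist z y :=
            dist_triangle_left _ _ _
        _ ≤ 2 * δ + R := add_le_add hdist (mem_closedBall.1 hzR)
        _ = R + 2 * δ := by ring
    obtain ⟨w, hw, hwu⟩ := hγ.exists_rebase (γ.dart_fst_mem_support_of_mem_darts hd) δ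
    exact ⟨d.fst, w, hw, hwu, hnear⟩

/-- Shifting the cell of a face by `a ∈ ℤ²` shifts its centre by `triEmbed a`. -/
theorem hexCenter_sub (F : HexVertex) (a : Site 2) :
    hexCenter (F.1 - a, F.2) = hexCenter F - triEmbed a := by
  simp only [hexCenter, triEmbed_sub]
  ring

/-- **Site-`𝕋`, mesh `1`, all centres**: the loops of `X_1(ω)` inside `B(y, κ)` are at most `M(κ)`
in number, uniformly in `y` and `ω` (they are interface loops through faces within `κ + 2` of `y`;
shifted by a lattice point within `7/10` of `y`, these are faces within `κ + 3` of the origin). -/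
theorem exists_ncard_sep_subset_ball_le_tEns_one (κ : ℝ) : ∃ M : ℕ, ∀ (y : ℂ) (ω : SiteConfig (Site 2)),
    {u ∈ (tEns.X 1 ω).loops | u.range ⊆ ball y κ}.Finite ∧
      {u ∈ (tEns.X 1 ω).loops | u.range ⊆ ball y κ}.ncard ≤ M := by
  classical
  set Φ₀ : Set HexVertex := {F | ‖((1 : ℝ) : ℂ) * hexCenter F‖ ≤ κ + 3} with hΦ₀
  have hΦ₀fin : Φ₀.Finite := finite_setOf_norm_hexCenter_le one_pos (κ + 3)
  refine ⟨hΦ₀fin.toFinset.card, fun y ω ↦ ?_⟩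
  obtain ⟨a, ha⟩ := exists_dist_triMeshPoint_le one_pos y
  have ha' : dist y (triEmbed a) ≤ 1 := by
    have : triMeshPoint 1 a = triEmbed a := by rw [triMeshPoint, Complex.ofReal_one, one_mul]
    rw [← this]; linarith
  set Φ : Set HexVertex := {F | dist (((1 : ℝ) : ℂ) * hexCenter F) y ≤ κ + 2} with hΦ
  -- the shift `F ↦ F - a` maps `Φ` injectively into `Φ₀`
  set sh : HexVertex → HexVertex := fun F ↦ (F.1 - a, F.2) with hsh
  have hsh_inj : Function.Injective sh := fun F G h ↦ by
    simp only [hsh, Prod.mk.injEq, sub_left_inj] at h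
    exact Prod.ext h.1 h.2
  have hmaps : Set.MapsTo sh Φ Φ₀ := fun F hF ↦ by
    simp only [hΦ, hΦ₀, mem_setOf_eq, Complex.ofReal_one, one_mul] at hF ⊢
    rw [hsh]
    dsimp only
    rw [hexCenter_sub]
    calc ‖hexCenter F - triEmbed a‖ = dist (hexCenter F) (triEmbed a) := (dist_eq_norm _ _).symm
      _ ≤ dist (hexCenter F) y + dist y (triEmbed a) := dist_triangle _ _ _
      _ ≤ κ + 2 + 1 := add_le_add hF ha'
      _ = κ + 3 := by ring
  have hΦfin : Φ.Finite :=
    Set.Finite.of_finite_image (hΦ₀fin.subset (Set.mapsTo_iff_image_subset.1 hmaps)) hsh_inj.injOn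
  have hΦcard : Φ.ncard ≤ hΦ₀fin.toFinset.card := by
    rw [← Set.ncard_eq_toFinset_card Φ₀ hΦ₀fin]
    exact Set.ncard_le_ncard_of_injOn sh hmaps hsh_inj.injOn hΦ₀fin
  -- THE loop of `ω` through a face (junk: the trivial walk)
  let g : HexVertex → UnbasedLoop ℂ := fun F ↦
    if h : ∃ w : hexGraph.Walk F F, IsSiteInterfaceLoop ω w then
      UnbasedLoop.mk (BasedLoop.mk (siteLoopCurve 1 h.choose) (isLoop_siteLoopCurve 1 _))
    else UnbasedLoop.mk (BasedLoop.mk (siteLoopCurve 1 (SimpleGraph.Walk.nil : hexGraph.Walk F F))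
      (isLoop_siteLoopCurve 1 _))
  have hsub : {u ∈ (tEns.X 1 ω).loops | u.range ⊆ ball y κ} ⊆ g '' Φ := by
    rintro u ⟨hu, hR⟩
    obtain ⟨z, hz⟩ := u.range_nonempty
    obtain ⟨F, w, hw, hwu, hF⟩ := exists_face_near_of_range_inter_closedBall_nonempty one_pos
      (show u ∈ (siteLoopConfig 1 ω).loops from hu) ⟨z, hz, ball_subset_closedBall (hR hz)⟩
    refine ⟨F, by rw [hΦ, mem_setOf_eq]; linarith, ?_⟩
    have h : ∃ w : hexGraph.Walk F F, IsSiteInterfaceLoop ω w := ⟨w, hw⟩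
    have hg : g F = UnbasedLoop.mk (BasedLoop.mk (siteLoopCurve 1 h.choose) (isLoop_siteLoopCurve 1 _)) :=
      dif_pos h
    rw [hg, h.choose_spec.eq_of_base_eq hw, hwu]
  have hfin : {u ∈ (tEns.X 1 ω).loops | u.range ⊆ ball y κ}.Finite := (hΦfin.image g).subset hsub
  refine ⟨hfin, ?_⟩
  calc {u ∈ (tEns.X 1 ω).loops | u.range ⊆ ball y κ}.ncard
      ≤ (g '' Φ).ncard := Set.ncard_le_ncard hsub (hΦfin.image g)
    _ ≤ Φ.ncard := Set.ncard_image_le hΦfin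
    _ ≤ hΦ₀fin.toFinset.card := hΦcard

/-! ## §4 Both lattices, all meshes -/

end UVFarBite

/-- **The number of microscopic loops in a ball is bounded, both lattice ensembles** (helper toward
Ξ `uvFarBite_expMoment_latticeEnsembles`, line `positive-cone-weight-doubling`).  For
`E ∈ latticeEnsembles` and every `κ` there is `M : ℕ` such that for every mesh `δ > 0`, every centre
`x` and every configuration, the loops of `X_δ` with trace inside `B(x, κδ)` form a finite set of at
most `M` elements — the deterministic input for the dyadic scales below the K6 threshold `c₀ δ` in
the multi-scale bound (dilation covariance reduces to mesh `1`; there, lattice translations on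
bond-`ℤ²` and a face count on site-`𝕋`). -/
theorem exists_ncard_loops_subset_ball_le : ∀ E ∈ latticeEnsembles, ∀ κ : ℝ, ∃ M : ℕ,
    ∀ (δ : ℝ), 0 < δ → ∀ (x : ℂ) (ω : E.Ω),
      {u ∈ (E.X δ ω).loops | u.range ⊆ Metric.ball x (κ * δ)}.Finite ∧
        {u ∈ (E.X δ ω).loops | u.range ⊆ Metric.ball x (κ * δ)}.ncard ≤ M := by
  intro E hE κ
  obtain ⟨M, hM⟩ : ∃ M : ℕ, ∀ (y : ℂ) (ω : E.Ω),
      {u ∈ (E.X 1 ω).loops | u.range ⊆ ball y κ}.Finite ∧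
        {u ∈ (E.X 1 ω).loops | u.range ⊆ ball y κ}.ncard ≤ M := by
    have hE' := hE
    simp only [latticeEnsembles, Set.mem_insert_iff, Set.mem_singleton_iff] at hE'
    rcases hE' with rfl | rfl
    · exact UVFarBite.exists_ncard_sep_subset_ball_le_zEns_one κ
    · exact UVFarBite.exists_ncard_sep_subset_ball_le_tEns_one κ
  refine ⟨M, fun δ hδ x ω ↦ ?_⟩
  rw [UVFarBite.sep_subset_ball_eq_image_mesh_one E hE hδ κ x ω]
  obtain ⟨hfin, hle⟩ := hM ((δ : ℂ)⁻¹ * x) ω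
  exact ⟨hfin.image _, by rwa [Set.ncard_image_of_injective _ (imageOn_mul_injective hδ.ne')]⟩

end Summit.CriticalPhenomena.CardyFormulaZ2.Cruxes.NestingRigidity.PositiveConeWeightDoubling

end
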